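import Summits.QuantumFields.YangMills.Theorems.ColdStartUniversalityLatticeLangevinLiebRobinsonEnergyLocality
import Summits.QuantumFields.YangMills.Theorems.ColdStartUniversalityLatticeLangevinLiebRobinsonLightCone
import HarnessLib

/-!
# Route `ColdStartUniversality` (fixed-cut-off SZZ dynamics; LIEB–ROBINSON / LOCALITY package, file 15):
# EQUILIBRIUM TIME-CORRELATIONS ARE FROZEN OUTSIDE THE LIGHT CONE — the semigroup interpolation of `⟨F, κ_T G⟩_μ`, every coupling

Helper file (seat `ym-line-csu-p1`, g31; `--supports stmt-QuantumFields-24809`).  The Lieb–Robinson half of the dynamic proof of EXPONENTIAL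
CLUSTERING of the `SU(2)` Wilson measure `μ_(β')` on `(ℤ/L)³` («Lieb–Robinson bound + spectral gap ⇒ clustering», Hastings–Koma mechanism in
a classical diffusion setting; Shen–Zhu–Zhu CMP 400 (2023) §4.3 / [GZ03 §8.3] shape, here with the tree's PATHWISE light cone instead of the
commutator iteration).  For ANY coupling `β'`, ANY volume `L`, ANY Markov kernel family `κ` realising the SZZ transition laws:
* ★ `wilson_integral_mul_transition_sub_eq` — for continuous `F` and `C³` compactly supported `g` (`G = g∘coords`, `𝓛g` its coordinate generator),
  `∫ F·κ_T G dμ − ∫ F·G dμ = ∫₀ᵀ (∫ F·κ_r(𝓛g) dμ) dr` (Dynkin in kernel form + Fubini); ★ `…_symm` — by detailed balance the integrand is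
  `∫ (𝓛g)·κ_r F dμ`;
* ★★★ `abs_integral_generator_mul_transition_le` — `|∫ (𝓛g)·κ_r F dμ| ≤ 8·e^(λr)·Σ_e Σ_e' ℓ^G_e ℓ^F_e' 108^(−D(e',e))`, `λ = (1300+4√2)|β'|`, `D` the
  cyclic sup-distance of base sites (Dynkin-class representative of `κ_r F` + its Lieb–Robinson profile + locality of the energy);
* ★★★ `wilson_integral_mul_transition_sub_le` — `|∫ F·κ_T G dμ − ∫ F·G dμ| ≤ 8·T·e^(λT)·Σ_e Σ_e' ℓ^G_e ℓ^F_e' 108^(−D(e',e))`: before the light cone of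
  `G` reaches the links of `F`, the equilibrium time-correlation does not move — uniformly in the volume.
THEOREMS ONLY, no definition, no sorry; [folklore] / [cite: ShenZhuZhu2022, §4.3].  HONEST FRAMING: fixed cut-off; every coupling here (the gap half,
`…LiebRobinsonClustering`, needs `|β'| < 1/12`); the cone speed `λ ∝ |β'|` blows up along the route's scaling `β'_K → ∞`, so nothing is `K`-uniform;
`UniformColdStartMixing` (24809) is NOT restated; no crux, rung or summit statement is proved; the Yang–Mills mass gap is NOT proved.
-/

set_option autoImplicit false

noncomputable section

namespace Summit.QuantumFields.YangMills.Theorems.ColdStartUniversality.LiebRobinson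

open MeasureTheory ProbabilityTheory Matrix Complex Finset Filter Set Metric intervalIntegral
open scoped ComplexConjugate BigOperators Matrix NNReal ENNReal Topology
open Literature.Probability.Process Literature.MathematicalPhysics.QuantumFieldTheory
open Literature.MathematicalPhysics.QuantumFieldTheory.Balaban1983to89
open Literature.MathematicalPhysics.QuantumLattice (fundamentalRep fundamentalLatticeRep continuous_fundamentalRep fundamentalRep_apply)

variable {L : ℕ} [NeZero L]

/-! ## §1. Semigroup interpolation of equilibrium correlations (every coupling) -/

/-- ★ **Semigroup interpolation of an equilibrium correlation.**  For every coupling `β'`, torus size `L`, Markov kernel family `κ`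
realising the SZZ transition laws, continuous `F : SU(2)^E → ℝ`, `C³` compactly supported `g` of the real link coordinates (`G = g∘coords`,
`𝓛g` its coordinate generator) and `T ≥ 0`:
`∫ F·(κ_T G) dμ_(β') − ∫ F·G dμ_(β') = ∫₀ᵀ (∫ F·κ_r(𝓛g) dμ_(β')) dr`  (Dynkin's formula in kernel form + Fubini). [folklore] -/
theorem wilson_integral_mul_transition_sub_eq (L : ℕ) [NeZero L] (β' : ℝ)
    (κ : ℝ≥0 → Kernel (GaugeConfig 3 L (Matrix.specialUnitaryGroup (Fin 2) ℂ))
      (GaugeConfig 3 L (Matrix.specialUnitaryGroup (Fin 2) ℂ))) [∀ t, IsMarkovKernel (κ t)]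
    (hreal : ∀ (t : ℝ≥0) (x : GaugeConfig 3 L (Matrix.specialUnitaryGroup (Fin 2) ℂ))
        (Ω : Type) [MeasurableSpace Ω] (P : Measure Ω) [IsProbabilityMeasure P]
        (W : ℝ≥0 → Ω → (Edge 3 L × NoiseIdx 2 → ℝ)) (hW : IsFlatBrownian W P)
        (U : ℝ≥0 → Ω → GaugeConfig 3 L (Matrix.specialUnitaryGroup (Fin 2) ℂ)),
        (∀ ω, U 0 ω = x) →
        (latticeLangevinDynamics (fundamentalLatticeRep 2) β').IsSolution (fundamentalRep (Fin 2))
          hW.natFiltration P W U →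
        κ t x = P.map (U t))
    {F : GaugeConfig 3 L (Matrix.specialUnitaryGroup (Fin 2) ℂ) → ℝ} (hF : Continuous F)
    {g : (Edge 3 L × Fin 2 × Fin 2 × Bool → ℝ) → ℝ} (hg : ContDiff ℝ 3 g) (hgc : HasCompactSupport g) {T : ℝ} (hT : 0 ≤ T) :
    let coords : GaugeConfig 3 L (Matrix.specialUnitaryGroup (Fin 2) ℂ) → (Edge 3 L × Fin 2 × Fin 2 × Bool → ℝ) :=
      fun V q => (fun z : ℂ => if q.2.2.2 then z.im else z.re)
        ((fundamentalRep (Fin 2) (V q.1) : Matrix (Fin 2) (Fin 2) ℂ) q.2.1 q.2.2.1)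
    let gen : GaugeConfig 3 L (Matrix.specialUnitaryGroup (Fin 2) ℂ) → ℝ := fun V =>
      (∑ i : Edge 3 L × Fin 2 × Fin 2 × Bool, fderiv ℝ g (coords V) (Pi.single i 1) *
          (fun z : ℂ => if i.2.2.2 then z.im else z.re)
            ((latticeLangevinDynamics (fundamentalLatticeRep 2) β').drift
              (matrixConfig (fundamentalRep (Fin 2)) V) i.1 i.2.1 i.2.2.1) +
      1 / 2 * ∑ i : Edge 3 L × Fin 2 × Fin 2 × Bool, ∑ j : Edge 3 L × Fin 2 × Fin 2 × Bool,
        fderiv ℝ (fun z => fderiv ℝ g z (Pi.single i 1)) (coords V) (Pi.single j 1) *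
          ∑ n : Edge 3 L × NoiseIdx 2,
            (if n.1 = i.1 then (fun z : ℂ => if i.2.2.2 then z.im else z.re)
              ((latticeLangevinDynamics (fundamentalLatticeRep 2) β').noise
                (matrixConfig (fundamentalRep (Fin 2)) V) i.1 n.2 i.2.1 i.2.2.1) else 0) *
            (if n.1 = j.1 then (fun z : ℂ => if j.2.2.2 then z.im else z.re)
              ((latticeLangevinDynamics (fundamentalLatticeRep 2) β').noise
                (matrixConfig (fundamentalRep (Fin 2)) V) j.1 n.2 j.2.1 j.2.2.1) else 0))
    (∫ x, F x * (∫ y, g (coords y) ∂(κ T.toNNReal x)) ∂(wilsonMeasure (d := 3) (L := L) (fundamentalRep (Fin 2)) β')) -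
        ∫ x, F x * g (coords x) ∂(wilsonMeasure (d := 3) (L := L) (fundamentalRep (Fin 2)) β') =
      ∫ r in (0 : ℝ)..T, (∫ x, F x * (∫ y, gen y ∂(κ r.toNNReal x)) ∂(wilsonMeasure (d := 3) (L := L) (fundamentalRep (Fin 2)) β')) := by
  intro coords gen
  classical
  haveI := secondCountableTopology_su2
  haveI := borelSpace_config L
  set μ : Measure (GaugeConfig 3 L (Matrix.specialUnitaryGroup (Fin 2) ℂ)) :=
    wilsonMeasure (d := 3) (L := L) (fundamentalRep (Fin 2)) β' with hμ
  haveI : IsProbabilityMeasure μ :=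
    isProbabilityMeasure_wilsonMeasure (d := 3) (L := L) (fundamentalRep (Fin 2)) (continuous_fundamentalRep (Fin 2)) β'
  have hco : Continuous coords := continuous_coords (L := L)
  have hGc : Continuous fun V => g (coords V) := hg.continuous.comp hco
  have hgen : Continuous gen := continuous_generator (L := L) β' (hg.of_le (by norm_num))
  have hDf : ∀ x, ∀ {τ : ℝ}, 0 ≤ τ →
      ∫ y, g (coords y) ∂(κ τ.toNNReal x) = g (coords x) + ∫ r in (0 : ℝ)..τ, (∫ y, gen y ∂(κ r.toNNReal x)) :=
    fun x τ hτ => transitionKernel_dynkin (L := L) β' κ hreal hg hgc x hτ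
  have hJ : Continuous (Function.uncurry fun (r : ℝ) (x : GaugeConfig 3 L (Matrix.specialUnitaryGroup (Fin 2) ℂ)) =>
      F x * ∫ y, gen y ∂(κ r.toNNReal x)) :=
    (hF.comp continuous_snd).mul ((continuous_transitionKernel_action β' κ hreal hgen).comp
      ((continuous_real_toNNReal.comp continuous_fst).prodMk continuous_snd))
  have hI : Continuous fun x : GaugeConfig 3 L (Matrix.specialUnitaryGroup (Fin 2) ℂ) =>
      ∫ r in (0 : ℝ)..T, F x * ∫ y, gen y ∂(κ r.toNNReal x) := by
    have h' : Continuous (Function.uncurry fun (x : GaugeConfig 3 L (Matrix.specialUnitaryGroup (Fin 2) ℂ)) (r : ℝ) =>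
        F x * ∫ y, gen y ∂(κ r.toNNReal x)) := hJ.comp continuous_swap
    exact intervalIntegral.continuous_parametric_intervalIntegral_of_continuous' h' 0 T
  have hpt : ∀ x, F x * (∫ y, g (coords y) ∂(κ T.toNNReal x)) =
      F x * g (coords x) + ∫ r in (0 : ℝ)..T, F x * ∫ y, gen y ∂(κ r.toNNReal x) := by
    intro x; rw [hDf x hT, mul_add, intervalIntegral.integral_const_mul]
  rw [integral_congr_ae (Eventually.of_forall hpt), integral_add (integrable_of_continuous_of_compactSpace
    (f := fun V => F V * g (coords V)) (hF.mul hGc) μ)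
    (integrable_of_continuous_of_compactSpace hI μ), integral_intervalIntegral_swap_of_continuous μ hJ hT]
  ring

/-- ★ **Symmetrised interpolation** (detailed balance `integral_mul_transition_symm_su2`): in the same setting,
`∫ F·(κ_T G) dμ_(β') − ∫ F·G dμ_(β') = ∫₀ᵀ (∫ (𝓛g)·(κ_r F) dμ_(β')) dr` — all the dynamics now acts on `F`. [folklore] -/
theorem wilson_integral_mul_transition_sub_eq_symm (L : ℕ) [NeZero L] (β' : ℝ)
    (κ : ℝ≥0 → Kernel (GaugeConfig 3 L (Matrix.specialUnitaryGroup (Fin 2) ℂ))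
      (GaugeConfig 3 L (Matrix.specialUnitaryGroup (Fin 2) ℂ))) [∀ t, IsMarkovKernel (κ t)]
    (hreal : ∀ (t : ℝ≥0) (x : GaugeConfig 3 L (Matrix.specialUnitaryGroup (Fin 2) ℂ))
        (Ω : Type) [MeasurableSpace Ω] (P : Measure Ω) [IsProbabilityMeasure P]
        (W : ℝ≥0 → Ω → (Edge 3 L × NoiseIdx 2 → ℝ)) (hW : IsFlatBrownian W P)
        (U : ℝ≥0 → Ω → GaugeConfig 3 L (Matrix.specialUnitaryGroup (Fin 2) ℂ)),
        (∀ ω, U 0 ω = x) →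
        (latticeLangevinDynamics (fundamentalLatticeRep 2) β').IsSolution (fundamentalRep (Fin 2))
          hW.natFiltration P W U →
        κ t x = P.map (U t))
    {F : GaugeConfig 3 L (Matrix.specialUnitaryGroup (Fin 2) ℂ) → ℝ} (hF : Continuous F)
    {g : (Edge 3 L × Fin 2 × Fin 2 × Bool → ℝ) → ℝ} (hg : ContDiff ℝ 3 g) (hgc : HasCompactSupport g) {T : ℝ} (hT : 0 ≤ T) :
    let coords : GaugeConfig 3 L (Matrix.specialUnitaryGroup (Fin 2) ℂ) → (Edge 3 L × Fin 2 × Fin 2 × Bool → ℝ) :=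
      fun V q => (fun z : ℂ => if q.2.2.2 then z.im else z.re)
        ((fundamentalRep (Fin 2) (V q.1) : Matrix (Fin 2) (Fin 2) ℂ) q.2.1 q.2.2.1)
    let gen : GaugeConfig 3 L (Matrix.specialUnitaryGroup (Fin 2) ℂ) → ℝ := fun V =>
      (∑ i : Edge 3 L × Fin 2 × Fin 2 × Bool, fderiv ℝ g (coords V) (Pi.single i 1) *
          (fun z : ℂ => if i.2.2.2 then z.im else z.re)
            ((latticeLangevinDynamics (fundamentalLatticeRep 2) β').drift
              (matrixConfig (fundamentalRep (Fin 2)) V) i.1 i.2.1 i.2.2.1) +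
      1 / 2 * ∑ i : Edge 3 L × Fin 2 × Fin 2 × Bool, ∑ j : Edge 3 L × Fin 2 × Fin 2 × Bool,
        fderiv ℝ (fun z => fderiv ℝ g z (Pi.single i 1)) (coords V) (Pi.single j 1) *
          ∑ n : Edge 3 L × NoiseIdx 2,
            (if n.1 = i.1 then (fun z : ℂ => if i.2.2.2 then z.im else z.re)
              ((latticeLangevinDynamics (fundamentalLatticeRep 2) β').noise
                (matrixConfig (fundamentalRep (Fin 2)) V) i.1 n.2 i.2.1 i.2.2.1) else 0) *
            (if n.1 = j.1 then (fun z : ℂ => if j.2.2.2 then z.im else z.re)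
              ((latticeLangevinDynamics (fundamentalLatticeRep 2) β').noise
                (matrixConfig (fundamentalRep (Fin 2)) V) j.1 n.2 j.2.1 j.2.2.1) else 0))
    (∫ x, F x * (∫ y, g (coords y) ∂(κ T.toNNReal x)) ∂(wilsonMeasure (d := 3) (L := L) (fundamentalRep (Fin 2)) β')) -
        ∫ x, F x * g (coords x) ∂(wilsonMeasure (d := 3) (L := L) (fundamentalRep (Fin 2)) β') =
      ∫ r in (0 : ℝ)..T, (∫ x, gen x * (∫ y, F y ∂(κ r.toNNReal x)) ∂(wilsonMeasure (d := 3) (L := L) (fundamentalRep (Fin 2)) β')) := by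
  intro coords gen
  have h := wilson_integral_mul_transition_sub_eq L β' κ hreal hF hg hgc hT
  have hgen : Continuous gen := continuous_generator (L := L) β' (hg.of_le (by norm_num))
  rw [h]
  refine intervalIntegral.integral_congr fun r _ => ?_
  exact integral_mul_transition_symm_su2 L β' κ hreal r.toNNReal hF hgen


/-! ## §2. The energy along the semigroup: Lieb–Robinson profile × profile of `g` (every coupling) -/

/-- ★★★ **The Dirichlet energy between `g` and `κ_r F` is exponentially small before the light cone of `F` reaches the links of `g`.**
For every coupling `β'`, torus size `L`, realising Markov kernel family `κ`, `C³` `f` whose pull-back `F = f∘coords` has a link-Lipschitz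
profile `ℓ^F ≥ 0`, `C³` compactly supported `g` with profile `ℓ^G ≥ 0`, and every lattice time `r`:
`|∫ (𝓛g)·(κ_r F) dμ_(β')| ≤ 8·e^(λr)·Σ_e Σ_e' ℓ^G_e·ℓ^F_e'·108^(−D(e',e))`, `λ = (1300+4√2)|β'|`, `D` = cyclic sup-distance of base sites
(`transitionKernel_preserves_dynkinClass` for a `C³_c` representative of `κ_r F`, its Lieb–Robinson profile `transitionKernel_linkLipschitz_profile`,
and the locality of the energy `abs_integral_mul_generator_le_of_linkLipschitz`). [folklore] -/
theorem abs_integral_generator_mul_transition_le (L : ℕ) [NeZero L] (β' : ℝ)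
    (κ : ℝ≥0 → Kernel (GaugeConfig 3 L (Matrix.specialUnitaryGroup (Fin 2) ℂ))
      (GaugeConfig 3 L (Matrix.specialUnitaryGroup (Fin 2) ℂ))) [∀ t, IsMarkovKernel (κ t)]
    (hreal : ∀ (t : ℝ≥0) (x : GaugeConfig 3 L (Matrix.specialUnitaryGroup (Fin 2) ℂ))
        (Ω : Type) [MeasurableSpace Ω] (P : Measure Ω) [IsProbabilityMeasure P]
        (W : ℝ≥0 → Ω → (Edge 3 L × NoiseIdx 2 → ℝ)) (hW : IsFlatBrownian W P)
        (U : ℝ≥0 → Ω → GaugeConfig 3 L (Matrix.specialUnitaryGroup (Fin 2) ℂ)),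
        (∀ ω, U 0 ω = x) →
        (latticeLangevinDynamics (fundamentalLatticeRep 2) β').IsSolution (fundamentalRep (Fin 2))
          hW.natFiltration P W U →
        κ t x = P.map (U t))
    {f : (Edge 3 L × Fin 2 × Fin 2 × Bool → ℝ) → ℝ} (hf : ContDiff ℝ 3 f) {ℓF : Edge 3 L → ℝ} (hℓF : ∀ e, 0 ≤ ℓF e)
    {g : (Edge 3 L × Fin 2 × Fin 2 × Bool → ℝ) → ℝ} (hg : ContDiff ℝ 3 g) (hgc : HasCompactSupport g) {ℓG : Edge 3 L → ℝ} (hℓG : ∀ e, 0 ≤ ℓG e)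
    (r : ℝ≥0) :
    let coords : GaugeConfig 3 L (Matrix.specialUnitaryGroup (Fin 2) ℂ) → (Edge 3 L × Fin 2 × Fin 2 × Bool → ℝ) :=
      fun V q => (fun z : ℂ => if q.2.2.2 then z.im else z.re)
        ((fundamentalRep (Fin 2) (V q.1) : Matrix (Fin 2) (Fin 2) ℂ) q.2.1 q.2.2.1)
    let gen : GaugeConfig 3 L (Matrix.specialUnitaryGroup (Fin 2) ℂ) → ℝ := fun V =>
      (∑ i : Edge 3 L × Fin 2 × Fin 2 × Bool, fderiv ℝ g (coords V) (Pi.single i 1) *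
          (fun z : ℂ => if i.2.2.2 then z.im else z.re)
            ((latticeLangevinDynamics (fundamentalLatticeRep 2) β').drift
              (matrixConfig (fundamentalRep (Fin 2)) V) i.1 i.2.1 i.2.2.1) +
      1 / 2 * ∑ i : Edge 3 L × Fin 2 × Fin 2 × Bool, ∑ j : Edge 3 L × Fin 2 × Fin 2 × Bool,
        fderiv ℝ (fun z => fderiv ℝ g z (Pi.single i 1)) (coords V) (Pi.single j 1) *
          ∑ n : Edge 3 L × NoiseIdx 2,
            (if n.1 = i.1 then (fun z : ℂ => if i.2.2.2 then z.im else z.re)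
              ((latticeLangevinDynamics (fundamentalLatticeRep 2) β').noise
                (matrixConfig (fundamentalRep (Fin 2)) V) i.1 n.2 i.2.1 i.2.2.1) else 0) *
            (if n.1 = j.1 then (fun z : ℂ => if j.2.2.2 then z.im else z.re)
              ((latticeLangevinDynamics (fundamentalLatticeRep 2) β').noise
                (matrixConfig (fundamentalRep (Fin 2)) V) j.1 n.2 j.2.1 j.2.2.1) else 0))
    (∀ (e : Edge 3 L) (y y' : (GaugeConfig 3 L (Matrix.specialUnitaryGroup (Fin 2) ℂ))), (∀ f', f' ≠ e → y f' = y' f') →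
      |f (coords y) - f (coords y')| ≤ ℓF e * frobNorm ((y e : Matrix (Fin 2) (Fin 2) ℂ) - (y' e : Matrix (Fin 2) (Fin 2) ℂ))) →
    (∀ (e : Edge 3 L) (y y' : (GaugeConfig 3 L (Matrix.specialUnitaryGroup (Fin 2) ℂ))), (∀ f', f' ≠ e → y f' = y' f') →
      |g (coords y) - g (coords y')| ≤ ℓG e * frobNorm ((y e : Matrix (Fin 2) (Fin 2) ℂ) - (y' e : Matrix (Fin 2) (Fin 2) ℂ))) →
    |∫ x, gen x * (∫ y, f (coords y) ∂(κ r x)) ∂(wilsonMeasure (d := 3) (L := L) (fundamentalRep (Fin 2)) β')| ≤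
      8 * Real.exp ((1300 + 4 * Real.sqrt 2) * |β'| * (r : ℝ)) * ∑ e : Edge 3 L, ∑ e' : Edge 3 L, ℓG e * ℓF e' * ((108 : ℝ)⁻¹) ^ (Finset.univ.sup fun i : Fin 3 => ((e'.1 i - e.1 i).valMinAbs).natAbs) := by
  intro coords gen hLf hLg
  classical
  have hco : Continuous coords := continuous_coords (L := L)
  have hFc : Continuous fun V => f (coords V) := hf.continuous.comp hco
  -- a `C³_c` representative of `κ_r F`
  obtain ⟨a, ha, hac, hrep⟩ := transitionKernel_preserves_dynkinClass L β' κ hreal r hf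
  -- its Lieb–Robinson link-Lipschitz profile
  set m : Edge 3 L → ℝ := fun e => Real.exp ((|β'| * (4 + 4 * Real.sqrt 2 + 12 * 108)) * (r : ℝ)) *
    ∑ e' : Edge 3 L, ℓF e' * ((108 : ℝ)⁻¹) ^ (Finset.univ.sup fun i : Fin 3 => ((e'.1 i - e.1 i).valMinAbs).natAbs) with hm
  have hm0 : ∀ e, 0 ≤ m e := fun e => by
    rw [hm]; exact mul_nonneg (Real.exp_pos _).le (Finset.sum_nonneg fun e' _ => mul_nonneg (hℓF e') (by positivity))
  have hLa : ∀ (e : Edge 3 L) (y y' : (GaugeConfig 3 L (Matrix.specialUnitaryGroup (Fin 2) ℂ))), (∀ f', f' ≠ e → y f' = y' f') →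
      |a (coords y) - a (coords y')| ≤ m e * frobNorm ((y e : Matrix (Fin 2) (Fin 2) ℂ) - (y' e : Matrix (Fin 2) (Fin 2) ℂ)) := by
    intro e y y' hyy'
    have h := transitionKernel_linkLipschitz_profile L β' κ hreal hFc hℓF hLf r e y y' hyy'
    rw [hrep y, hrep y'] at h
    simpa only [hm] using h
  have hswap : ∫ x, gen x * (∫ y, f (coords y) ∂(κ r x)) ∂(wilsonMeasure (d := 3) (L := L) (fundamentalRep (Fin 2)) β') =
      ∫ x, a (coords x) * gen x ∂(wilsonMeasure (d := 3) (L := L) (fundamentalRep (Fin 2)) β') := by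
    refine integral_congr_ae (Eventually.of_forall fun x => ?_)
    show gen x * (∫ y, f (coords y) ∂(κ r x)) = a (coords x) * gen x
    rw [hrep x, mul_comm]
  rw [hswap]
  have key := abs_integral_mul_generator_le_of_linkLipschitz L β' ha hac hg hgc hm0 hℓG hLa hLg
  refine key.trans (le_of_eq ?_)
  have hlam : |β'| * (4 + 4 * Real.sqrt 2 + 12 * 108) = (1300 + 4 * Real.sqrt 2) * |β'| := by ring
  simp only [hm, hlam]
  rw [Finset.mul_sum, Finset.mul_sum]
  refine Finset.sum_congr rfl fun e _ => ?_
  rw [Finset.mul_sum, Finset.mul_sum, Finset.sum_mul, Finset.mul_sum]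
  refine Finset.sum_congr rfl fun e' _ => ?_
  ring

/-! ## §3. Before the light cone arrives, equilibrium time-correlations do not move (every coupling) -/

/-- ★★★ **Equilibrium time-correlations are frozen outside the light cone.**  For every coupling `β'`, torus size `L`, realising
Markov kernel family `κ`, `C³` `f` (pull-back profile `ℓ^F ≥ 0`), `C³` compactly supported `g` (profile `ℓ^G ≥ 0`) and every `T ≥ 0`:
`|∫ F·(κ_T G) dμ_(β') − ∫ F·G dμ_(β')| ≤ 8·T·e^(λT)·Σ_e Σ_e' ℓ^G_e·ℓ^F_e'·108^(−D(e',e))`, `λ = (1300+4√2)|β'|`.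
When the profiles are supported in sets of links at mutual sup-distance `> R` the double sum is `≤ 108^(−(R+1))·(Σℓ^F)(Σℓ^G)`: the
correlation at time `T` differs from the static one by `≲ T·e^(λT − (R+1) log 108)`, uniformly in the volume — the Lieb–Robinson half of
exponential clustering (`…LiebRobinsonClustering`). [folklore] -/
theorem wilson_integral_mul_transition_sub_le (L : ℕ) [NeZero L] (β' : ℝ)
    (κ : ℝ≥0 → Kernel (GaugeConfig 3 L (Matrix.specialUnitaryGroup (Fin 2) ℂ))
      (GaugeConfig 3 L (Matrix.specialUnitaryGroup (Fin 2) ℂ))) [∀ t, IsMarkovKernel (κ t)]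
    (hreal : ∀ (t : ℝ≥0) (x : GaugeConfig 3 L (Matrix.specialUnitaryGroup (Fin 2) ℂ))
        (Ω : Type) [MeasurableSpace Ω] (P : Measure Ω) [IsProbabilityMeasure P]
        (W : ℝ≥0 → Ω → (Edge 3 L × NoiseIdx 2 → ℝ)) (hW : IsFlatBrownian W P)
        (U : ℝ≥0 → Ω → GaugeConfig 3 L (Matrix.specialUnitaryGroup (Fin 2) ℂ)),
        (∀ ω, U 0 ω = x) →
        (latticeLangevinDynamics (fundamentalLatticeRep 2) β').IsSolution (fundamentalRep (Fin 2))
          hW.natFiltration P W U →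
        κ t x = P.map (U t))
    {f : (Edge 3 L × Fin 2 × Fin 2 × Bool → ℝ) → ℝ} (hf : ContDiff ℝ 3 f) {ℓF : Edge 3 L → ℝ} (hℓF : ∀ e, 0 ≤ ℓF e)
    {g : (Edge 3 L × Fin 2 × Fin 2 × Bool → ℝ) → ℝ} (hg : ContDiff ℝ 3 g) (hgc : HasCompactSupport g) {ℓG : Edge 3 L → ℝ} (hℓG : ∀ e, 0 ≤ ℓG e)
    {T : ℝ} (hT : 0 ≤ T) :
    let coords : GaugeConfig 3 L (Matrix.specialUnitaryGroup (Fin 2) ℂ) → (Edge 3 L × Fin 2 × Fin 2 × Bool → ℝ) :=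
      fun V q => (fun z : ℂ => if q.2.2.2 then z.im else z.re)
        ((fundamentalRep (Fin 2) (V q.1) : Matrix (Fin 2) (Fin 2) ℂ) q.2.1 q.2.2.1)
    (∀ (e : Edge 3 L) (y y' : (GaugeConfig 3 L (Matrix.specialUnitaryGroup (Fin 2) ℂ))), (∀ f', f' ≠ e → y f' = y' f') →
      |f (coords y) - f (coords y')| ≤ ℓF e * frobNorm ((y e : Matrix (Fin 2) (Fin 2) ℂ) - (y' e : Matrix (Fin 2) (Fin 2) ℂ))) →
    (∀ (e : Edge 3 L) (y y' : (GaugeConfig 3 L (Matrix.specialUnitaryGroup (Fin 2) ℂ))), (∀ f', f' ≠ e → y f' = y' f') →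
      |g (coords y) - g (coords y')| ≤ ℓG e * frobNorm ((y e : Matrix (Fin 2) (Fin 2) ℂ) - (y' e : Matrix (Fin 2) (Fin 2) ℂ))) →
    |(∫ x, f (coords x) * (∫ y, g (coords y) ∂(κ T.toNNReal x)) ∂(wilsonMeasure (d := 3) (L := L) (fundamentalRep (Fin 2)) β')) -
        ∫ x, f (coords x) * g (coords x) ∂(wilsonMeasure (d := 3) (L := L) (fundamentalRep (Fin 2)) β')| ≤
      8 * T * Real.exp ((1300 + 4 * Real.sqrt 2) * |β'| * T) * ∑ e : Edge 3 L, ∑ e' : Edge 3 L, ℓG e * ℓF e' * ((108 : ℝ)⁻¹) ^ (Finset.univ.sup fun i : Fin 3 => ((e'.1 i - e.1 i).valMinAbs).natAbs) := by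
  intro coords hLf hLg
  classical
  have hco : Continuous coords := continuous_coords (L := L)
  have hFc : Continuous fun V => f (coords V) := hf.continuous.comp hco
  have hsymm := wilson_integral_mul_transition_sub_eq_symm L β' κ hreal hFc hg hgc hT
  rw [hsymm, ← Real.norm_eq_abs]
  set S : ℝ := ∑ e : Edge 3 L, ∑ e' : Edge 3 L, ℓG e * ℓF e' * ((108 : ℝ)⁻¹) ^ (Finset.univ.sup fun i : Fin 3 => ((e'.1 i - e.1 i).valMinAbs).natAbs) with hS
  have hS0 : 0 ≤ S := Finset.sum_nonneg fun e _ => Finset.sum_nonneg fun e' _ =>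
    mul_nonneg (mul_nonneg (hℓG e) (hℓF e')) (by positivity)
  have h8 : (0 : ℝ) ≤ 8 := by norm_num
  refine (intervalIntegral.norm_integral_le_of_norm_le_const (C := 8 * Real.exp ((1300 + 4 * Real.sqrt 2) * |β'| * T) * S) fun r hr => ?_).trans ?_
  · rw [Set.uIoc_of_le hT] at hr
    rw [Real.norm_eq_abs]
    refine (abs_integral_generator_mul_transition_le L β' κ hreal hf hℓF hg hgc hℓG r.toNNReal hLf hLg).trans ?_
    have hr' : ((r.toNNReal : ℝ≥0) : ℝ) = r := Real.coe_toNNReal _ hr.1.le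
    rw [hr']
    have hexp : Real.exp ((1300 + 4 * Real.sqrt 2) * |β'| * r) ≤ Real.exp ((1300 + 4 * Real.sqrt 2) * |β'| * T) :=
      Real.exp_le_exp.2 (mul_le_mul_of_nonneg_left hr.2 (by positivity))
    exact mul_le_mul_of_nonneg_right (mul_le_mul_of_nonneg_left hexp h8) hS0
  · rw [sub_zero, abs_of_nonneg hT]
    exact le_of_eq (by ring)

end Summit.QuantumFields.YangMills.Theorems.ColdStartUniversality.LiebRobinson
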